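import Summits.BirchSwinnertonDyer.BirchSwinnertonDyer.Theorems.SignedLowerHalvesKobayashiLowerHalfSemistableDefmuMuCarrierV4
import Summits.BirchSwinnertonDyer.BirchSwinnertonDyer.Theorems.SignedLowerHalvesKobayashiLowerHalfSemistableDefiniteFrameData
import Literature.NumberTheory.EllipticCurves.SkinnerUrban2014.PAdicUnitPeriodRatioProofs
import Literature.NumberTheory.EllipticCurves.BurungaleSkinnerTianWan2024.SignedTwoVariableDefinitePackagePinnedPRE
import Literature.NumberTheory.EllipticCurves.RibetTakahashiDefinitePrime
import Literature.NumberTheory.EllipticCurves.TakahashiDegreeFormulaFromDictionary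
import Literature.NumberTheory.EllipticCurves.GrossPointsTowerExistence
import Literature.NumberTheory.EllipticCurves.ModularParametrizationBCDTProofs
import HarnessLib

/-!
# Line «defmu» of crux 2 `KobayashiLowerHalfSemistable` (stmt-BirchSwinnertonDyer-19000), skeleton v5 (VARIANT-N restub):
# the HARD stub Cμ′ `stub_definitePackageMuCarrier` CLOSED modulo the typed (P4b) binder BY NAME — the definite
# `μ`-carrier `(S, φ, T)` is SUPPLIED from proved theorems of the tree —, and the crux BODY from two cite packs
# (PUBLISHED / PREPRINT named facts, by name) plus the `p = 3` residual

Route-independent `Theorems` file of the cell `bsd-ssimc`, seat `bsd-line-slh-p2` (LEAD of crux 2, gen 18), after the EVENT that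
gens 8–17 named as `blocked-on`: the literature seat `bsd-armP-typer-04` typed BSTW Part II Thm. 10.5 proof, case (def), as the
binder `thm105def_exists_signedTwoVariablePackage_pinnedToGrossPoints_supersingular_PRE` (p719417; UNREFEREED preprint, claim-tagged,
never a theorem) in EXACTLY the currency of the v4 stub Cμ′, with the consumability certificate `exists_muCarrier_of_pinned`
("the binder + ANY carrier ⟹ the stub's conclusion verbatim"). HONEST FRAMING: nothing about any curve is asserted, NO summit
statement is proved, BSD / the crux is NOT proved; §1–§2 are unconditional algebra / bookkeeping, §3–§4 are IMPLICATIONS from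
named facts displayed in full (two of them unrefereed-preprint binders).

§1 (PROVED, unconditional). A `ℤ`-submodule of `ℤ^ι` of rank one is a line `ℤ φ`, `φ ≠ 0`
(`exists_eq_span_singleton_of_finrank_eq_one`; submodules of `ℤ^ι` are free).

§2 (PROVED modulo modularity and multiplicity one BY NAME). **The definite `μ`-carrier of Cμ′ EXISTS** at the datum of the line (`W` with `ClassX6 W p`,
`N = N_W`, `K` imaginary quadratic with `p` split and `(N, D_K) = 1`, ONE bad prime `q₀ ∥ N` inert, the others split):
a Brandt setup `S` of type `(N/q₀, q₀)` — `nonempty_xiSetup_of_prime` (Vignéras / Eichler, PROVED: `nonempty_eichlerPackage_holds`);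
its class set is finite (`XiSetup.instFiniteClassSet`); a generator `φ ≠ 0` of the `a(W)`-eigen-line — multiplicity one
`takahashi2001_brandtEigenLattice_rank_one` (Takahashi 2001 p. 78 / Pizer Thm. 2.28; taken BY NAME: its discharge
`takahashi2001_brandtEigenLattice_rank_one_holds` — PROVED from the Eichler–Selberg trace identities, file
`TakahashiDegreeFormulaFromDictionaryHolds` — sits on a module chain (`PopaZagierHeckeElementB1CasesA` …) that is UNBUILT on the farm at
2026-08-29T13:20Z, `lean check` rc 75 `remote:stale:unbuilt`; discharge = one term once built) needs a parametrisation datum at level `N`,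
i.e. modularity `nonempty_modularParametrizationData` (PUBLISHED named fact, by name), and §1; a tower `T` of
Gross points of `p`-power conductor — `nonempty_grossPointTower_holds` (Bertolini–Darmon Lemma 2.2, PROVED), whose Heegner
hypotheses are the datum's (`N` square-free from semistability, `(N p, D_K) = 1` from `p` split, `p ∤ N` from good reduction).
`exists_muCarrier`; with Pollack–Weston Thm. 2.5 BY NAME the carrier has `μ(L_n) = 0` (`exists_muCarrier_hasMuZeroLAc`, `5 ≤ p`).

§3. **Cμ′ CLOSED MOD PRINT**: `definitePackageMuCarrier_of_pinned : thm105def_…_PRE → nonempty_modularParametrizationData →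
takahashi2001_brandtEigenLattice_rank_one → ⟨stub_definitePackageMuCarrier, v4 signature VERBATIM⟩` — `exists_muCarrier_of_pinned` at the carrier of §2; the two datum
bridges are `ClassX6 ⇒ N` square-free (`isSemistable_iff_squarefree_conductorNorm`) and "`2` split or `2 ∣ N`" `∧ (N, D_K) = 1
⇒ D_K` odd (`Quadratic.ncard_primesOver_two_eq_two_iff`: `2` split iff `D_K ≡ 1 (mod 8)`).

§4. **The crux BODY from two cite packs and the `p = 3` residual** (`kobayashiLowerHalfSemistable_body_of_citePacks`): the v4
body `SemistableDefmuMuCarrierV4.kobayashiLowerHalfSemistable_body_of_stubs₅` fed with S1aʳ ⟸ modularity + Diamond 1995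
(`SemistableDefiniteFrameData.ramifiedLevelPrimeR_of_levelLowering`, p625644; `exists_isNewformOf` ⟸ `nonempty_modularParametrizationData`
by `exists_isNewformOf_of_nonempty_modularParametrizationData`), Cμ′ ⟸ §3, `acMuInput` = Pollack–Weston BY NAME, NamedInputs₂ ⟸
its conjuncts with the period unit from Mazur Cor. 4.1 (`SkinnerUrban2014.realPeriodRat_eq_unit_mul_plusPeriod_of_mazur`, as in the
INPUTS desk's `InputsNamedTwo.namedInputsTwo_of_mazur`, p640651 — not imported: that file sits in the Theses cone), S7 kept as a
hypothesis. The PUBLISHED pack: Kobayashi 2003 Thms. 1.2 / 4.1, modularity (BCDT), multiplicity one (Takahashi 2001 p. 78; `_holds` in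
the tree, unbuilt on the farm), Mazur 1978 Cor. 4.1, Diamond 1995 Thm. 1.1, Pollack–Weston 2011 Thm. 2.5 (i). The PREPRINT pack (arXiv:2409.01350v2, OPEN binders): BSTW Thm. 6.17, Thm. 9.24, Thm. 10.5
proof case (def). This is the composition target of `Lines/defmu.lean` v5 (VARIANT-N: cite stubs [CITE-ONLY] + content stub
`stub_threeResidual`).

§5 (v2 of this file). `exists_kobayashiLowerDivisibility_five_le_of_citePacks`: the `5 ≤ p` half ALONE from the two cite packs (no S7) —
the «closed mod print: <ten names>» reading as one citable kernel theorem.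

Stub ledger after v5 (numbers, not adjectives): registered stubs 3 (2 cite-only + 1 content); named facts 10 (PUB 7 — one of them,
multiplicity one, already a tree theorem whose module is unbuilt on the farm —, PRE 3);
kernel-closable today 0; the `5 ≤ p` half of the crux is closed MODULO PRINT (the ten names), the `p = 3` half is the research
residual S7 (= BSTW Thm. 1.3 at `p = 3`, PRE; tree: `stub_three_of_thm13_scopedAtThree_OPEN_of_published`). Kernel state of the
crux: UNCHANGED (OPEN; PRE). Nothing of BSTW is asserted.

References: [BurungaleSkinnerTianWan2024] arXiv:2409.01350v2 Part II Thm. 10.5 proof (def), Thms. 6.17, 9.24; [PollackWeston2011]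
Compos. Math. 147 §2.1, Thm. 2.5 (i); [Takahashi2001] J. Number Theory 90, §2 p. 78; [BertoliniDarmon1996] Lemma 2.2, §2.4;
[VignerasLNM800] III Thm. 3.1; [Mazur1978] Cor. 4.1; [Diamond1995RefinedSerre] Thm. 1.1; [Kobayashi2003] Thms. 1.2, 4.1; [BCDTJAMS2001];
cell files `Cruxes/KobayashiLowerHalfSemistable/{Lines/defmu.lean, Lines/defmu.md, PICKED.md}`.
-/

-- D-0017: single-problem summit, the namespace repeats the problem name by design.
set_option linter.dupNamespace false
set_option autoImplicit false

noncomputable section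

open scoped Classical

open NumberField IsDedekindDomain Field CongruenceSubgroup
open Literature.NumberTheory.GaloisRepresentations
open Literature.NumberTheory.EllipticCurves Literature.NumberTheory.EllipticCurves.BurungaleSkinnerTianWan2024
open Literature.NumberTheory.EllipticCurves.ModularForms
open Literature.NumberTheory.Automorphic

namespace Summit.BirchSwinnertonDyer.BirchSwinnertonDyer.Theorems.SemistableDefmuMuCarrierPinned

/-! ### §1. A rank-one sublattice of `ℤ^ι` is a line (PROVED) -/

/-- **A `ℤ`-submodule of `ℤ^ι` of rank one is `ℤ φ` with `φ ≠ 0`.** Submodules of the free `ℤ`-module `ℤ^ι` are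
free (`Submodule.nonempty_basis_of_pid`, `ι` finite); a free module of rank one is spanned by one non-zero vector
(`finrank_eq_one_iff'`). [folklore] -/
theorem exists_eq_span_singleton_of_finrank_eq_one {ι : Type*} [Finite ι] {L : Submodule ℤ (ι → ℤ)}
    (h : Module.finrank ℤ L = 1) : ∃ φ : ι → ℤ, φ ≠ 0 ∧ L = ℤ ∙ φ := by
  obtain ⟨n, ⟨b⟩⟩ := Submodule.nonempty_basis_of_pid (Pi.basisFun ℤ ι) L
  haveI : Module.Free ℤ L := Module.Free.of_basis b
  obtain ⟨v, hv0, hv⟩ := finrank_eq_one_iff'.mp h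
  refine ⟨(v : ι → ℤ), fun h0 => hv0 (Subtype.ext h0), le_antisymm ?_ ?_⟩
  · intro w hw
    obtain ⟨c, hc⟩ := hv ⟨w, hw⟩
    exact Submodule.mem_span_singleton.mpr ⟨c, by simpa using congrArg Subtype.val hc⟩
  · exact (Submodule.span_singleton_le_iff_mem _ _).mpr v.2

/-- Multiplicity one read at a parametrisation datum whose level `L` is only PROPOSITIONALLY `M·r` (level transport by `subst`;
private plumbing for `exists_muCarrier`, where the datum lives at level `N_W` and the Brandt setup at `(N/q₀)·q₀`). [cite: Takahashi2001, §2 p. 78] -/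
private theorem finrank_eigenLattice_eq_one_of_level_eq (hT1 : takahashi2001_brandtEigenLattice_rank_one)
    (W : WeierstrassCurve ℚ) [W.IsElliptic] {M r L : ℕ} [NeZero (M * r)] [NeZero L] (hr : r.Prime)
    (hsq : Squarefree (M * r)) (hN : W.conductorNorm ℤ = M * r) (hL : L = M * r) (P : ModularParametrizationData W L)
    (S : Brandt.XiSetup M r) [Fintype (Brandt.ClassSet S.O)] :
    Module.finrank ℤ (Brandt.eigenLattice (M * r) (Brandt.matrix S.O) (fun n => W.LFunction n)) = 1 := by
  subst hL
  exact hT1 W M r hr hsq hN P S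

/-! ### §2. The definite `μ`-carrier of Cμ′ exists (PROVED modulo modularity and multiplicity one BY NAME) -/

/-- **A definite `μ`-carrier `(S, φ, T)` of type `(N/q₀, q₀)` EXISTS at the datum of line «defmu».** For `W/ℚ` globally minimal
with `ClassX6 W p` (`p` odd good supersingular, semistable), `N = N_W`, `K` imaginary quadratic with `p` split and `(N, D_K) = 1`,
a prime `q₀ ∥ N` inert in `K` and every other `ℓ ∣ N` split: there are a Brandt setup `S : Brandt.XiSetup (N/q₀) q₀` (definite
quaternion algebra of discriminant `q₀`, Eichler order of level `N/q₀`; `nonempty_xiSetup_of_prime`, PROVED) with finite class set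
(`XiSetup.instFiniteClassSet`), a generator `φ ≠ 0` of the `a(W)`-eigen-line of its Brandt module (multiplicity one
`takahashi2001_brandtEigenLattice_rank_one` BY NAME = `hT1` — its `_holds` is a tree theorem on a farm-unbuilt module chain —, at a
parametrisation datum of level `N` supplied by the named fact `hmod` = modularity; `exists_eq_span_singleton_of_finrank_eq_one`) and a tower `T` of Gross points of `p`-power conductor
(`nonempty_grossPointTower_holds`, PROVED; Heegner hypotheses from the datum as in `SemistableDefmuMuCarrier.hasMuZeroLAc_of_pollackWeston`).
CONDITIONAL on modularity and multiplicity one BY NAME; closes nothing. [cite: Takahashi2001, §2 p. 78] [cite: BertoliniDarmon1996, Lemma 2.2 and §2.4]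
[cite: VignerasLNM800, Ch. III §3 Thm. 3.1] [cite: PollackWeston2011, §2.1] -/
theorem exists_muCarrier (hmod : nonempty_modularParametrizationData)
    (hT1 : takahashi2001_brandtEigenLattice_rank_one)
    {p : ℕ} [Fact p.Prime] (W : WeierstrassCurve ℚ) [W.IsElliptic] [W.IsGloballyMinimal]
    (K : Type) [Field K] [NumberField K] {N : ℕ} [NeZero N] (hN : (N : ℤ) = W.conductorNorm ℤ) (hp : p ≠ 2)
    (hIQ : IsImaginaryQuadratic K) (hsp : ((Ideal.span {(p : ℤ)}).primesOver (𝓞 K)).ncard = 2)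
    (hcop : IsCoprime (N : ℤ) (NumberField.discr K)) (hX : Rank1Residual.ClassX6 W p) {q₀ : ℕ} (hq₀ : q₀.Prime)
    (hqN : q₀ ∣ N) (hq2 : ¬ (q₀ ^ 2 ∣ N)) (hin : ((Ideal.span {(q₀ : ℤ)}).primesOver (𝓞 K)).ncard = 1)
    (hspl : ∀ ℓ : ℕ, ℓ.Prime → ℓ ∣ N → ℓ ≠ q₀ → ((Ideal.span {(ℓ : ℤ)}).primesOver (𝓞 K)).ncard = 2) :
    ∃ (S : Brandt.XiSetup (N / q₀) q₀) (_ : Fintype (Brandt.ClassSet S.O)) (φ : Brandt.ClassSet S.O → ℤ)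
      (_ : GrossPointTower K S p),
      φ ≠ 0 ∧ Brandt.eigenLattice (N / q₀ * q₀) (Brandt.matrix S.O) (fun n => W.LFunction n) = ℤ ∙ φ := by
  have hNnat : N = W.conductorNorm ℤ := by exact_mod_cast hN
  have hmul : N / q₀ * q₀ = N := Nat.div_mul_cancel hqN
  have hNc : N / q₀ * q₀ = W.conductorNorm ℤ := hmul.trans hNnat
  have hN0 : 0 < N := Nat.pos_of_ne_zero (NeZero.ne N)
  have hM : 0 < N / q₀ := Nat.div_pos (Nat.le_of_dvd hN0 hqN) hq₀.pos
  have hndvd : ¬ q₀ ∣ N / q₀ := fun h => hq2 (by rw [sq]; exact (Nat.dvd_div_iff_mul_dvd hqN).mp h)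
  have hMq : (N / q₀).Coprime q₀ := (Nat.Prime.coprime_iff_not_dvd hq₀).mpr hndvd |>.symm
  -- the Brandt setup and its finite class set
  obtain ⟨S⟩ := nonempty_xiSetup_of_prime hM hq₀ hMq
  letI instF : Fintype (Brandt.ClassSet S.O) := Fintype.ofFinite (Brandt.ClassSet S.O)
  -- the datum: `N` square-free (semistable), `(N p, D_K) = 1`, `p ∤ N`, split / inert primes of `N/q₀` / `q₀`
  have hsq : Squarefree (N / q₀ * q₀) := by
    rw [hNc]
    exact (W.isSemistable_iff_squarefree_conductorNorm).mp
      ((Rank1Residual.semistable_iff_isSemistable_int (W := W)).mp hX.2.1)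
  have hcopN : (N / q₀ * q₀ * p).Coprime (NumberField.discr K).natAbs := by
    rw [hmul]; exact SemistableDefmuMuCarrier.coprime_mul_discr_of_split hIQ hp hsp hcop
  have hpN : ¬ p ∣ N / q₀ * q₀ := by
    rw [hNc]; exact not_dvd_conductorNorm_of_hasGoodReductionAtPrime W hX.1.1
  have hsplit : ∀ ℓ : ℕ, ℓ.Prime → ℓ ∣ N / q₀ → ((Ideal.span {(ℓ : ℤ)}).primesOver (𝓞 K)).ncard = 2 :=
    fun ℓ hℓ hℓd => hspl ℓ hℓ (SemistableDefmuMuCarrier.ne_of_dvd_div hqN hq2 hℓd).1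
      (SemistableDefmuMuCarrier.ne_of_dvd_div hqN hq2 hℓd).2
  have hinert : ∀ ℓ : ℕ, ℓ.Prime → ℓ ∣ q₀ → ((Ideal.span {(ℓ : ℤ)}).primesOver (𝓞 K)).ncard = 1 := by
    intro ℓ hℓ hℓd
    obtain rfl := (Nat.prime_dvd_prime_iff_eq hℓ hq₀).mp hℓd
    exact hin
  -- the generator of the eigen-line: multiplicity one at a parametrisation datum of level `N = (N/q₀)·q₀`
  haveI : NeZero (N / q₀ * q₀) := ⟨by rw [hmul]; exact NeZero.ne N⟩
  haveI : NeZero (W.conductorNorm ℤ) := ⟨by rw [← hNnat]; exact NeZero.ne N⟩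
  obtain ⟨P⟩ := hmod W
  have hrk : Module.finrank ℤ
      (Brandt.eigenLattice (N / q₀ * q₀) (Brandt.matrix S.O) (fun n => W.LFunction n)) = 1 :=
    finrank_eigenLattice_eq_one_of_level_eq hT1 W hq₀ hsq hNc.symm hNc.symm P S
  obtain ⟨φ, hφ0, hφ⟩ := exists_eq_span_singleton_of_finrank_eq_one hrk
  -- the tower of Gross points
  obtain ⟨T⟩ := nonempty_grossPointTower_holds K S p hIQ hsq hcopN hpN hsplit hinert
  exact ⟨S, instF, φ, T, hφ0, hφ⟩

/-- **The carrier of `exists_muCarrier` has `μ(L_n) = 0` for `n ≫ 0`, GRANTED Pollack–Weston Thm. 2.5 (i) BY NAME** (`hPW`), at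
`5 ≤ p` (the Lemma 2.1 normalisation of the generator is automatic: `SemistableDefmuMuCarrierV4.exists_not_dvd_weight_mul_apply`).
So at the datum of the line the hypothesis of the (PIN) clause is met by a carrier that exists. CONDITIONAL on three PUBLISHED
named facts (modularity, multiplicity one, Pollack–Weston); closes nothing. [cite: PollackWeston2011, Thm. 2.5 (i)]
[cite: Takahashi2001, §2 p. 78] [cite: BertoliniDarmon1996, Lemma 2.2 and §2.4] -/
theorem exists_muCarrier_hasMuZeroLAc (hmod : nonempty_modularParametrizationData)
    (hT1 : takahashi2001_brandtEigenLattice_rank_one)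
    (hPW : ∀ (K : Type) [Field K] [NumberField K] {Nplus Nminus : ℕ} (S : Brandt.XiSetup Nplus Nminus)
      (p : ℕ) [Fact p.Prime] (W : WeierstrassCurve ℚ), pollackWeston2011_thm_2_5_hasMuZeroLAc K S p W)
    {p : ℕ} [Fact p.Prime] (W : WeierstrassCurve ℚ) [W.IsElliptic] [W.IsGloballyMinimal]
    (K : Type) [Field K] [NumberField K] {N : ℕ} [NeZero N] (hN : (N : ℤ) = W.conductorNorm ℤ) (hp : p ≠ 2)
    (h5 : 5 ≤ p) (ha0 : W.frobeniusTrace p = 0)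
    (hIQ : IsImaginaryQuadratic K) (hsp : ((Ideal.span {(p : ℤ)}).primesOver (𝓞 K)).ncard = 2)
    (hcop : IsCoprime (N : ℤ) (NumberField.discr K)) (hX : Rank1Residual.ClassX6 W p) {q₀ : ℕ} (hq₀ : q₀.Prime)
    (hqN : q₀ ∣ N) (hq2 : ¬ (q₀ ^ 2 ∣ N)) (hin : ((Ideal.span {(q₀ : ℤ)}).primesOver (𝓞 K)).ncard = 1)
    (hspl : ∀ ℓ : ℕ, ℓ.Prime → ℓ ∣ N → ℓ ≠ q₀ → ((Ideal.span {(ℓ : ℤ)}).primesOver (𝓞 K)).ncard = 2) :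
    ∃ (S : Brandt.XiSetup (N / q₀) q₀) (_ : Fintype (Brandt.ClassSet S.O)) (φ : Brandt.ClassSet S.O → ℤ)
      (T : GrossPointTower K S p),
      φ ≠ 0 ∧ Brandt.eigenLattice (N / q₀ * q₀) (Brandt.matrix S.O) (fun n => W.LFunction n) = ℤ ∙ φ ∧
      T.HasMuZeroLAc p φ := by
  obtain ⟨S, instF, φ, T, hφ0, hφ⟩ := exists_muCarrier hmod hT1 W K hN hp hIQ hsp hcop hX hq₀ hqN hq2 hin hspl
  exact ⟨S, instF, φ, T, hφ0, hφ,
    SemistableDefmuMuCarrier.hasMuZeroLAc_of_pollackWeston hPW W K hN hp ha0 hIQ hsp hcop hX hq₀ hqN hq2 hin hspl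
      S φ hφ0 hφ (SemistableDefmuMuCarrierV4.exists_not_dvd_weight_mul_apply S hφ0 hφ Fact.out h5) T⟩

/-! ### §3. Cμ′ `stub_definitePackageMuCarrier` (v4 signature VERBATIM) CLOSED modulo the (P4b) binder and modularity BY NAME -/

/-- **Stub Cμ′ `stub_definitePackageMuCarrier` of line «defmu» (v4 signature VERBATIM as the conclusion), CONDITIONAL on the typed
(P4b) binder `thm105def_exists_signedTwoVariablePackage_pinnedToGrossPoints_supersingular_PRE` (BSTW Part II Thm. 10.5 proof, case
(def): UNREFEREED PREPRINT, claim-tagged, never a theorem), on modularity `nonempty_modularParametrizationData` and on multiplicity one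
`takahashi2001_brandtEigenLattice_rank_one` (PUBLISHED; the latter's `_holds` is a tree theorem on a farm-unbuilt module), all BY NAME.** Proof: `exists_muCarrier_of_pinned` (the binder read at `(N⁺, N⁻) = (N/q₀, q₀)`) at the carrier of `exists_muCarrier`; the
datum bridges `ClassX6 ⇒ N_W` square-free (`isSemistable_iff_squarefree_conductorNorm`) and "`2` split or `2 ∣ N`" with
`(N, D_K) = 1 ⇒ D_K` odd (`Quadratic.ncard_primesOver_two_eq_two_iff`). CONDITIONAL (`conditional-result`); it itemises the stub's
print dependence and does NOT assert the binder. [claim: BurungaleSkinnerTianWan2024, status: under-review]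
[cite: BurungaleSkinnerTianWan2024, Part II Thm. 10.5 proof, case (def) (PDF v2 p. 88)] [cite: Takahashi2001, §2 p. 78]
[cite: BertoliniDarmon1996, Lemma 2.2 and §2.4] -/
theorem definitePackageMuCarrier_of_pinned
    (h105 : thm105def_exists_signedTwoVariablePackage_pinnedToGrossPoints_supersingular_PRE)
    (hmod : nonempty_modularParametrizationData) (hT1 : takahashi2001_brandtEigenLattice_rank_one) :
    ∀ {p : ℕ} [Fact p.Prime] (ι : PadicAlgCl p ≃+* ℂ) (W : WeierstrassCurve ℚ) [W.IsElliptic]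
      [W.IsGloballyMinimal] (K : Type) [Field K] [NumberField K] (v vbar : HeightOneSpectrum (𝓞 K))
      (κ₁ κ₂ : ZpExtension K p) (γ₁ γ₂ : absoluteGaloisGroup K)
      [Fact (ZpExtension.IsTopGeneratorPair κ₁ κ₂ γ₁ γ₂)] {N : ℕ} [NeZero N] (f : CuspForm (Gamma0 N) 2)
      [NeZero (NumberField.discr K).natAbs],
      IsNewformOf W f → (N : ℤ) = W.conductorNorm ℤ → p ≠ 2 → ¬ (p : ℤ) ∣ W.conductorNorm ℤ →
      W.frobeniusTrace p = 0 →
      IsImaginaryQuadratic K → ((Ideal.span {(p : ℤ)}).primesOver (𝓞 K)).ncard = 2 →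
      ((p : ℕ) : 𝓞 K) ∈ v.asIdeal → ((p : ℕ) : 𝓞 K) ∈ vbar.asIdeal → vbar ≠ v →
      (∀ (w : InfinitePlace K) (k : 𝓞 K), k ∈ v.asIdeal ↔ ‖ι.symm (w.embedding (k : K))‖ < 1) →
      IsCoprime (N : ℤ) (NumberField.discr K) →
      -- ⟨definite-CR datum, rev 5: X6 at 5 ≤ p; ONE prime q₀ ∥ N inert in K, every other ℓ ∣ N split; `2` split or
      --  `2 ∣ N` ((spl) of BSTW Thm 9.24); (CR, RAMIFIED branch only) `p ∤ v_{q₀}(Δ_W)` (ρ̄ ramified at q₀, `p ∤ c_{q₀}`)⟩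
      5 ≤ p → Rank1Residual.ClassX6 W p →
      ∀ q₀ : ℕ, q₀.Prime → q₀ ∣ N → ¬ (q₀ ^ 2 ∣ N) →
        ((Ideal.span {(q₀ : ℤ)}).primesOver (𝓞 K)).ncard = 1 →
        (∀ ℓ : ℕ, ℓ.Prime → ℓ ∣ N → ℓ ≠ q₀ → ((Ideal.span {(ℓ : ℤ)}).primesOver (𝓞 K)).ncard = 2) →
        (((Ideal.span {(2 : ℤ)}).primesOver (𝓞 K)).ncard = 2 ∨ 2 ∣ N) →
        ¬ ((p : ℤ) ∣ padicValRat q₀ W.Δ) →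
      (∀ ρ : ModPGaloisRep K (ZMod p) 2, (W.baseChange K).IsTorsionGaloisRep p ρ →
        FramedRep.IsAbsolutelyIrreducible ρ) →
      κ₁.IsCyclotomic → κ₂.IsAnticyclotomic →
      ∀ (Ω δ : ℂ) (Ωp : (unrIntegers p)ˣ) (LK G : PowerSeries (PowerSeries (PadicComplexInt p))),
        Ω ≠ 0 → (δ ^ 2 = (NumberField.discr K : ℂ) ∨ δ ^ 2 = -(NumberField.discr K : ℂ)) →
        IsKatzMeasure₂ ι v vbar ∅ κ₁ κ₂ γ₁⁻¹ γ₂⁻¹ 1 Ω δ ((Ωp : unrIntegers p) : PadicComplex p) LK →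
        IsGreenbergLFunctionAnyRoot₂ ι v vbar κ₁ κ₂ γ₁⁻¹ γ₂⁻¹ f (NumberField.discr K).natAbs
          (NumberField.classNumber K) LK G →
      ∀ J : ℤ_[p] →+* PadicComplexInt p,
        (∀ x : ℤ_[p], ((J x : PadicComplexInt p) : PadicComplex p) = ((x : ℚ_[p]) : PadicComplex p)) →
      ∀ ε : ℤˣ,
      ∃ xi Lsig : PowerSeries (PowerSeries (PadicComplexInt p)),
        (∃ (S : Brandt.XiSetup (N / q₀) q₀) (_ : Fintype (Brandt.ClassSet S.O))
            (φ : Brandt.ClassSet S.O → ℤ) (T : GrossPointTower K S p),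
            φ ≠ 0 ∧
            Brandt.eigenLattice (N / q₀ * q₀) (Brandt.matrix S.O) (fun n => W.LFunction n) = ℤ ∙ φ ∧
            (T.HasMuZeroLAc p φ → GreenbergVatsal2000.HasUnitContent (UnrSeries₂.minus Lsig))) ∧
        (Ideal.span {xi * G} =
            (WeierstrassCurve.XGr₂.charIdeal (W.baseChange K) p κ₁ κ₂ vbar γ₁ γ₂).map
                (IwasawaAlgebra₂.toUnr₂ p J) * Ideal.span {Lsig} ∧
        ∀ (κ : ZpExtension ℚ p) (γ : absoluteGaloisGroup ℚ), κ.IsCyclotomic → κ.IsTopGenerator γ →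
          IsCyclotomicVariable p γ →
          (∃ ζ : ℤ_[p]ˣ, IsOfFinOrder ζ ∧
            GaloisRep.cyclotomicCharacter ℚ p γ * ζ = GaloisRep.cyclotomicCharacter K p γ₁) →
          ∀ (W₂ : WeierstrassCurve ℚ) [W₂.IsElliptic] [W₂.IsGloballyMinimal]
            (C₂ : WeierstrassCurve.VariableChange ℚ),
            C₂ • W₂ = W.quadraticTwist (NumberField.discr K : ℚ) →
            (∀ (D₁ : Kobayashi2003.SignedSelmerDualData W κ γ ε)
                (D₂ : Kobayashi2003.SignedSelmerDualData W₂ κ γ ε) (g₁ g₂ : IwasawaAlgebra p),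
                D₁.charIdeal = Ideal.span {g₁} → D₂.charIdeal = Ideal.span {g₂} →
                UnrSeries₂.plus xi ∣ PowerSeries.map J (g₁ * g₂)) ∧
            (∀ {N₂ : ℕ} [NeZero N₂] (f₂ : CuspForm (Gamma0 N₂) 2), IsNewformOf W₂ f₂ →
              ∀ (L₁ L₂ : IwasawaAlgebra p), Kobayashi2003.IsSignedPAdicLFunction f p ε L₁ →
                Kobayashi2003.IsSignedPAdicLFunction f₂ p ε L₂ →
                ∃ u : PowerSeries (PadicComplexInt p), IsUnit u ∧
                  UnrSeries₂.plus Lsig = u * PowerSeries.map J (L₁ * L₂))) := by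
  intro p _ ι W _ _ K _ _ v vbar κ₁ κ₂ γ₁ γ₂ _ N _ f _ hf hN hp hpN ha0 hIQ hsp hv hvbar hvv hι hcop h5 hX q₀ hq₀ hqN
    hq2 hin hspl h2K hCR hirr hκ₁ hκ₂ Ω δ Ωp LK G hΩ hδ hLK hGr J hJ ε
  -- datum bridge 1: `ClassX6 ⇒` semistable `⇒ N = N_W` square-free
  have hNnat : N = W.conductorNorm ℤ := by exact_mod_cast hN
  have hsq : Squarefree N := by
    rw [hNnat]
    exact (W.isSemistable_iff_squarefree_conductorNorm).mp
      ((Rank1Residual.semistable_iff_isSemistable_int (W := W)).mp hX.2.1)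
  -- datum bridge 2: "`2` split or `2 ∣ N`" with `(N, D_K) = 1` `⇒ D_K` odd
  have hodd : Odd (NumberField.discr K) := by
    rcases h2K with h2 | h2
    · have h8 := (Literature.NumberTheory.QuadraticFields.Quadratic.ncard_primesOver_two_eq_two_iff hIQ.1).mp h2
      rw [Int.odd_iff]; omega
    · have h2N : (2 : ℤ) ∣ (N : ℤ) := by exact_mod_cast h2
      have hnd : ¬ (2 : ℤ) ∣ NumberField.discr K := fun hd =>
        Int.prime_two.not_unit (hcop.isUnit_of_dvd' h2N hd)
      rw [Int.odd_iff]; omega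
  -- the carrier, then the binder
  obtain ⟨S, instF, φ, T, hφ0, hφ⟩ := exists_muCarrier hmod hT1 W K hN hp hIQ hsp hcop hX hq₀ hqN hq2 hin hspl (p := p)
  exact exists_muCarrier_of_pinned h105 ι W K v vbar κ₁ κ₂ γ₁ γ₂ f hf hN hp hpN ha0 hIQ hsp hv hvbar hvv hι hcop hsq
    hodd hq₀ hqN hin hspl hCR hirr hκ₁ hκ₂ Ω δ Ωp LK G hΩ hδ hLK hGr J hJ ε S φ hφ0 hφ T

/-! ### §4. The crux BODY from two cite packs (PUBLISHED / PREPRINT, by name) and the `p = 3` residual -/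

/-- **The BODY of crux 2 `Theses.SignedLowerHalves.KobayashiLowerHalfSemistable` from the two CITE PACKS of skeleton v5 and the
`p = 3` residual** (`hpub` = `stub_publishedInputs`: Kobayashi 2003 Thm. 1.2 ∧ Thm. 4.1 ∧ modularity ∧ multiplicity one (Takahashi
2001 p. 78) ∧ Mazur 1978 Cor. 4.1 ∧ Diamond 1995 Thm. 1.1 ∧ Pollack–Weston 2011 Thm. 2.5 (i), all PUBLISHED named facts BY NAME; `hpre` = `stub_preprintInputs`:
BSTW Thm. 6.17 ∧ Thm. 9.24 ∧ Thm. 10.5 proof case (def), UNREFEREED-PREPRINT binders BY NAME; `h7` = `stub_threeResidual`):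
for every globally minimal `W/ℚ` and prime `p ≠ 2` with `ClassX6 W p`, `∃ ε, KobayashiLowerDivisibility W p ε`. The v4 body
`SemistableDefmuMuCarrierV4.kobayashiLowerHalfSemistable_body_of_stubs₅` with S1aʳ ⟸ `ramifiedLevelPrimeR_of_levelLowering`
(modularity via `exists_isNewformOf_of_nonempty_modularParametrizationData`, Diamond 1995), Cμ′ ⟸ `definitePackageMuCarrier_of_pinned`,
`acMuInput` = Pollack–Weston, NamedInputs₂ ⟸ its conjuncts, the period unit by `realPeriodRat_eq_unit_mul_plusPeriod_of_mazur`.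
Route-independent (no `Theses` import in the closure). CONDITIONAL (`conditional-result`); closes
nothing; the item stays OPEN (PRE). [claim: BurungaleSkinnerTianWan2024, status: under-review]
[cite: BurungaleSkinnerTianWan2024, Thm. 6.17, Thm. 9.24, Part II Thm. 10.5 proof case (def)] [cite: Kobayashi2003, Thm. 1.2, Thm. 4.1]
[cite: PollackWeston2011, Thm. 2.5 (i)] [cite: Mazur1978, Cor. 4.1] [cite: Diamond1995RefinedSerre, Thm. 1.1] [cite: Takahashi2001, §2 p. 78] -/
theorem kobayashiLowerHalfSemistable_body_of_citePacks
    (hpub :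
      Kobayashi2003.thm12_signedSelmerDual_finite_torsion ∧ Kobayashi2003.thm41_signedCharIdeal_divisibility ∧
        nonempty_modularParametrizationData ∧ takahashi2001_brandtEigenLattice_rank_one ∧
        mazur_not_dvd_maninConstant_of_odd ∧
        Literature.NumberTheory.Automorphic.diamond1995_refinedSerre ∧
        (∀ (K : Type) [Field K] [NumberField K] {Nplus Nminus : ℕ} (S : Brandt.XiSetup Nplus Nminus)
          (p : ℕ) [Fact p.Prime] (W : WeierstrassCurve ℚ), pollackWeston2011_thm_2_5_hasMuZeroLAc K S p W))
    (hpre :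
      thm617_exists_isGreenbergLFunctionAnyRoot₂_supersingular_PRE ∧
        thm924_greenberg_dvd_charIdealXGr₂_awayFromCyc_OPEN ∧
        thm105def_exists_signedTwoVariablePackage_pinnedToGrossPoints_supersingular_PRE)
    (h7 :
      ∀ (W : WeierstrassCurve ℚ) [W.IsElliptic] [W.IsGloballyMinimal], Rank1Residual.ClassX6 W 3 →
        ∃ ε : ℤˣ, Summit.BirchSwinnertonDyer.Rank1Residual.Supersingular.KobayashiLowerDivisibility W 3 ε) :
    ∀ (W : WeierstrassCurve ℚ) [W.IsElliptic] [W.IsGloballyMinimal] (p : ℕ) [Fact p.Prime], p ≠ 2 →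
      Rank1Residual.ClassX6 W p →
      ∃ ε : ℤˣ, Summit.BirchSwinnertonDyer.Rank1Residual.Supersingular.KobayashiLowerDivisibility W p ε :=
  SemistableDefmuMuCarrierV4.kobayashiLowerHalfSemistable_body_of_stubs₅
    (SemistableDefiniteFrameData.ramifiedLevelPrimeR_of_levelLowering
      (exists_isNewformOf_of_nonempty_modularParametrizationData hpub.2.2.1) hpub.2.2.2.2.2.1)
    (definitePackageMuCarrier_of_pinned hpre.2.2 hpub.2.2.1 hpub.2.2.2.1)
    hpub.2.2.2.2.2.2
    ⟨⟨hpre.1, hpub.1, hpub.2.1, hpub.2.2.1,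
      SkinnerUrban2014.realPeriodRat_eq_unit_mul_plusPeriod_of_mazur hpub.2.2.2.2.1⟩, hpre.2.1⟩
    h7

/-! ### §5. The `5 ≤ p` half of crux 2 as ONE kernel theorem from the two cite packs ALONE («closed mod print», v5 reading) -/

/-- **The `5 ≤ p` half of crux 2 `KobayashiLowerHalfSemistable` CLOSED MODULO PRINT, as one kernel theorem**: for every globally
minimal `W/ℚ` and prime `p ≥ 5` with `ClassX6 W p`, `∃ ε, KobayashiLowerDivisibility W p ε`, GRANTED exactly the two cite packs of skeleton
v5 — `hpub` (seven PUBLISHED named facts: Kobayashi 2003 Thm. 1.2 ∧ Thm. 4.1 ∧ modularity ∧ multiplicity one ∧ Mazur 1978 Cor. 4.1 ∧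
Diamond 1995 Thm. 1.1 ∧ Pollack–Weston 2011 Thm. 2.5 (i)) and `hpre` (three UNREFEREED-PREPRINT binders of arXiv:2409.01350v2: Thm. 6.17 ∧
Thm. 9.24 ∧ Part II Thm. 10.5 proof case (def)) — and NO `p = 3` residual. Proof: p630247's `SemistableDefmuAssemblyStubs.exists_kobayashiLowerDivisibility_of_stubs`
at S1aʳ ⟸ `ramifiedLevelPrimeR_of_levelLowering`, Cμ (v2 form) rebuilt pointwise from Cμ′ (`definitePackageMuCarrier_of_pinned`) ⊕ Pollack–Weston
by `SemistableDefmuMuCarrierV4.exists_package_of_muCarrier`, NamedInputs₂ ⟸ its conjuncts + Mazur. This is the director's «closed mod print: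
<the ten names>» reading of the `5 ≤ p` half as a citable declaration (e.g. for a planner who splits the crux at `p = 3`). CONDITIONAL
(`conditional-result`); closes nothing; the item stays OPEN (PRE). [claim: BurungaleSkinnerTianWan2024, status: under-review]
[cite: BurungaleSkinnerTianWan2024, Thm. 6.17, Thm. 9.24, Part II Thm. 10.5 proof case (def)] [cite: Kobayashi2003, Thm. 1.2, Thm. 4.1]
[cite: PollackWeston2011, Thm. 2.5 (i)] [cite: Mazur1978, Cor. 4.1] [cite: Diamond1995RefinedSerre, Thm. 1.1] [cite: Takahashi2001, §2 p. 78] -/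
theorem exists_kobayashiLowerDivisibility_five_le_of_citePacks
    (hpub :
      Kobayashi2003.thm12_signedSelmerDual_finite_torsion ∧ Kobayashi2003.thm41_signedCharIdeal_divisibility ∧
        nonempty_modularParametrizationData ∧ takahashi2001_brandtEigenLattice_rank_one ∧
        mazur_not_dvd_maninConstant_of_odd ∧
        Literature.NumberTheory.Automorphic.diamond1995_refinedSerre ∧
        (∀ (K : Type) [Field K] [NumberField K] {Nplus Nminus : ℕ} (S : Brandt.XiSetup Nplus Nminus)
          (p : ℕ) [Fact p.Prime] (W : WeierstrassCurve ℚ), pollackWeston2011_thm_2_5_hasMuZeroLAc K S p W))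
    (hpre :
      thm617_exists_isGreenbergLFunctionAnyRoot₂_supersingular_PRE ∧
        thm924_greenberg_dvd_charIdealXGr₂_awayFromCyc_OPEN ∧
        thm105def_exists_signedTwoVariablePackage_pinnedToGrossPoints_supersingular_PRE)
    (W : WeierstrassCurve ℚ) [W.IsElliptic] [W.IsGloballyMinimal] (p : ℕ) [Fact p.Prime]
    (hp : p ≠ 2) (hX : Rank1Residual.ClassX6 W p) (h5p : 5 ≤ p) :
    ∃ ε : ℤˣ, Summit.BirchSwinnertonDyer.Rank1Residual.Supersingular.KobayashiLowerDivisibility W p ε := by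
  refine SemistableDefmuAssemblyStubs.exists_kobayashiLowerDivisibility_of_stubs
    (SemistableDefiniteFrameData.ramifiedLevelPrimeR_of_levelLowering
      (exists_isNewformOf_of_nonempty_modularParametrizationData hpub.2.2.1) hpub.2.2.2.2.2.1) ?_
    ⟨⟨hpre.1, hpub.1, hpub.2.1, hpub.2.2.1,
      SkinnerUrban2014.realPeriodRat_eq_unit_mul_plusPeriod_of_mazur hpub.2.2.2.2.1⟩, hpre.2.1⟩
    W p hp hX h5p
  intro p _ ι W _ _ K _ _ v vbar κ₁ κ₂ γ₁ γ₂ _ N _ f _ hf hN hp hpN ha0 hIQ hsp hv hvbar hvv hι hcop h5 hX q₀ hq₀ hqN hq2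
    hin hspl h2K hCR hirr hκ₁ hκ₂ Ω δ Ωp LK G hΩ hδ hLK hGr J hJ ε
  exact SemistableDefmuMuCarrierV4.exists_package_of_muCarrier hpub.2.2.2.2.2.2 W K vbar κ₁ κ₂ γ₁ γ₂ f hN hp h5 ha0 hIQ hsp
    hcop hX hq₀ hqN hq2 hin hspl G J ε
    (definitePackageMuCarrier_of_pinned hpre.2.2 hpub.2.2.1 hpub.2.2.2.1 ι W K v vbar κ₁ κ₂ γ₁ γ₂ f hf hN hp hpN ha0 hIQ
      hsp hv hvbar hvv hι hcop h5 hX q₀ hq₀ hqN hq2 hin hspl h2K hCR hirr hκ₁ hκ₂ Ω δ Ωp LK G hΩ hδ hLK hGr J hJ ε)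

end Summit.BirchSwinnertonDyer.BirchSwinnertonDyer.Theorems.SemistableDefmuMuCarrierPinned

end
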